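import Summits.AtomisticToContinuum.FouriersLaw.Theorems.PhononMeanFreePathCoherentDephasingStrictAbsorptionPrep
import Summits.AtomisticToContinuum.FouriersLaw.Theorems.PhononMeanFreePathCoherentDephasingStrictAbsorptionPolyDynkin
import Summits.AtomisticToContinuum.FouriersLaw.Theorems.PhononMeanFreePathCoherentDephasingStrictAbsorptionGeneratorAlgebra
import Summits.AtomisticToContinuum.FouriersLaw.Theorems.PhononMeanFreePathCoherentDephasingStrictAbsorptionClassBounds
import Summits.AtomisticToContinuum.FouriersLaw.Theorems.BondHeatUncertaintySubdiffusiveBondHeatBathBondReductionDynkin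

/-!
# Strict absorption — the third-order short-time expansion of the which-path witness
# (line `Sketch`, crux `PhononMeanFreePath.CoherentDephasing`, stmt-AtomisticToContinuum-11810, lead c2)

For the `(N+1)`-site pinned anharmonic chain with both baths at `T` (`N ≥ 2`), Gibbs law `μ`, kernels `K_s`, the local
curvature `Φ = U''(q₀) + V''(q₁-q₀)`, `Φ̃ = Φ - ⟨Φ⟩`, the weight `a = p₀Φ̃` and the witness
`A(r) = ⟨a, K_r p₀⟩_μ = T·Cov_μ(∂_{p₀}K_r p₀, Φ)`:

  `|A(r) + T·Var(Φ)·r²/2| ≤ ((‖a‖² + ‖G₃‖²)/2)·r³/6`   for all `r ≥ 0`,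

where `G₃ = L³p₀` is the third generator power at the kicked site. Proof: three Dynkin steps
(`sa_polyDynkin` on `p₀`, `G₁ = Lp₀`, `G₂ = LG₁` — generator algebra `sa_generatorAlgebra`, class bounds
`sa_classBounds`, the third power supplied as a hypothesis), paired with `a` under the invariant law
(`pinnedChain_integral_mul_act_sub_of_dynkin`); the statics `⟨a,p₀⟩ = ⟨a,G₁⟩ = 0`, `⟨a,G₂⟩ = -T Var Φ` (`sa_statics`);
`|⟨a, K_w G₃⟩| ≤ (‖a‖² + ‖G₃‖²)/2` (`prep_abs_corr_le`); and the third-order envelope `prep_taylor3`. So the averaged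
tangent response `∂_{p₀}K_r p₀ = 1 - γr + (r²/2)(γ² - Φ) + …` acquires VARIANCE `≈ (r²/2)² Var Φ > 0` from the thermal
curvature fluctuations — the mechanism of strict absorption. No definition, no `sorry`, standard axioms.
-/

noncomputable section

open MeasureTheory ProbabilityTheory Filter Topology Set intervalIntegral
open scoped NNReal ENNReal

namespace Summit.AtomisticToContinuum.FouriersLaw.Theorems.CoherentDephasing.StrictAbsorption

open Literature.MathematicalPhysics.KineticTheory.HeatConduction
open Literature.MathematicalPhysics.KineticTheory Literature.Probability.Process OscillatorChain
open Summit.AtomisticToContinuum.FouriersLaw.Theorems.SubdiffusiveBondHeat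
open Summit.AtomisticToContinuum.FouriersLaw.Theorems.CoherentDephasing.MeanFieldDuhamel (partialP_snd abs_snd_le)

/-- **The third-order expansion of the which-path witness** (the third generator power `G₃ = L G₂` supplied as data:
continuity, the identity `L G₂ = G₃`, and a fixed-`N` growth bound). For every `r ≥ 0`,
`|⟨p₀Φ̃, K_r p₀⟩ + T·Var(Φ)·r²/2| ≤ ((∫(p₀Φ̃)² + ∫G₃²)/2)·r³/6`. [folklore] -/
theorem expansion_of_cube {ω₂ lam β γ : ℝ} (hω : 0 < ω₂) (hl : 0 < lam) (hβ : 0 < β) (hγ : 0 < γ)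
    {T : ℝ} (hT : 0 < T) {N : ℕ} (hN : 2 ≤ N) {G₃ : PhaseSpace (N + 1) → ℝ} (hG₃c : Continuous G₃)
    (hgen₃ : ∀ z : PhaseSpace (N + 1),
      (pinnedChain ω₂ lam β γ).generator (N + 1) T T (fun y : PhaseSpace (N + 1) => (-(y.2 0 * (ω₂ + 3 * lam * y.1 0 ^ 2 + 1 + 3 * β * (y.1 ⟨1, by omega⟩ - y.1 0) ^ 2)) + y.2 ⟨1, by omega⟩ * (1 + 3 * β * (y.1 ⟨1, by omega⟩ - y.1 0) ^ 2) + γ * (ω₂ * y.1 0 + lam * y.1 0 ^ 3 - ((y.1 ⟨1, by omega⟩ - y.1 0) + β * (y.1 ⟨1, by omega⟩ - y.1 0) ^ 3)) + γ ^ 2 * y.2 0)) z = G₃ z)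
    {B₃ : ℝ} (hB₃ : ∀ z, |G₃ z| ≤ B₃ * (1 + (pinnedChain ω₂ lam β γ).hamiltonian (N + 1) z) ^ 3)
    (r : ℝ) (hr : 0 ≤ r) :
    |(∫ z, (z.2 0 * ((ω₂ + 3 * lam * z.1 0 ^ 2 + 1 + 3 * β * (z.1 ⟨1, by omega⟩ - z.1 0) ^ 2) - ∫ x, (ω₂ + 3 * lam * x.1 0 ^ 2 + 1 + 3 * β * (x.1 ⟨1, by omega⟩ - x.1 0) ^ 2) ∂((pinnedChain ω₂ lam β γ).gibbsMeasure (N + 1) T))) *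
        (∫ y, y.2 0 ∂((pinnedChain ω₂ lam β γ).transitionKernel (N + 1) T T r.toNNReal z)) ∂((pinnedChain ω₂ lam β γ).gibbsMeasure (N + 1) T)) +
      T * (∫ z, ((ω₂ + 3 * lam * z.1 0 ^ 2 + 1 + 3 * β * (z.1 ⟨1, by omega⟩ - z.1 0) ^ 2) - ∫ x, (ω₂ + 3 * lam * x.1 0 ^ 2 + 1 + 3 * β * (x.1 ⟨1, by omega⟩ - x.1 0) ^ 2) ∂((pinnedChain ω₂ lam β γ).gibbsMeasure (N + 1) T)) ^ 2 ∂((pinnedChain ω₂ lam β γ).gibbsMeasure (N + 1) T)) * r ^ 2 / 2| ≤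
      ((∫ z, (z.2 0 * ((ω₂ + 3 * lam * z.1 0 ^ 2 + 1 + 3 * β * (z.1 ⟨1, by omega⟩ - z.1 0) ^ 2) - ∫ x, (ω₂ + 3 * lam * x.1 0 ^ 2 + 1 + 3 * β * (x.1 ⟨1, by omega⟩ - x.1 0) ^ 2) ∂((pinnedChain ω₂ lam β γ).gibbsMeasure (N + 1) T))) ^ 2 ∂((pinnedChain ω₂ lam β γ).gibbsMeasure (N + 1) T)) + ∫ z, G₃ z ^ 2 ∂((pinnedChain ω₂ lam β γ).gibbsMeasure (N + 1) T)) / 2 * r ^ 3 / 6 := by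
  set P := pinnedChain ω₂ lam β γ with hP
  set μ := P.gibbsMeasure (N + 1) T with hμ
  haveI : IsProbabilityMeasure μ := pinnedChain_isProbabilityMeasure_gibbsMeasure hω hl.le hβ.le γ (N + 1) hT
  have hNp : 0 < N + 1 := Nat.succ_pos N
  -- the explicit observables
  set p0f : PhaseSpace (N + 1) → ℝ := fun y => y.2 0 with hp0f
  set G1f : PhaseSpace (N + 1) → ℝ := fun y => (-(ω₂ * y.1 0 + lam * y.1 0 ^ 3) + ((y.1 ⟨1, by omega⟩ - y.1 0) + β * (y.1 ⟨1, by omega⟩ - y.1 0) ^ 3) - γ * y.2 0) with hG1f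
  set G2f : PhaseSpace (N + 1) → ℝ := fun y => (-(y.2 0 * (ω₂ + 3 * lam * y.1 0 ^ 2 + 1 + 3 * β * (y.1 ⟨1, by omega⟩ - y.1 0) ^ 2)) + y.2 ⟨1, by omega⟩ * (1 + 3 * β * (y.1 ⟨1, by omega⟩ - y.1 0) ^ 2) + γ * (ω₂ * y.1 0 + lam * y.1 0 ^ 3 - ((y.1 ⟨1, by omega⟩ - y.1 0) + β * (y.1 ⟨1, by omega⟩ - y.1 0) ^ 3)) + γ ^ 2 * y.2 0) with hG2f
  set Φf : PhaseSpace (N + 1) → ℝ := fun z => (ω₂ + 3 * lam * z.1 0 ^ 2 + 1 + 3 * β * (z.1 ⟨1, by omega⟩ - z.1 0) ^ 2) with hΦf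
  set Φbar : ℝ := ∫ x, Φf x ∂μ with hΦbar
  set a : PhaseSpace (N + 1) → ℝ := fun z => z.2 0 * (Φf z - Φbar) with ha
  set VΦ : ℝ := ∫ z, (Φf z - Φbar) ^ 2 ∂μ with hVΦ
  -- landed sub-goals
  obtain ⟨hgen1, hgen2, hG1c2, hG2c2⟩ := sa_generatorAlgebra ω₂ lam β γ hω hl hβ hγ T hT N hN
  obtain ⟨Cb, hCb0, hcls⟩ := sa_classBounds ω₂ lam β γ hω hl hβ hγ T hT N hN
  obtain ⟨hst1, hst2, hst3, hst4⟩ := sa_statics ω₂ lam β γ hω hl hβ hγ T hT N hN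
  have hH0 : ∀ y, 0 ≤ P.hamiltonian (N + 1) y := fun y =>
    pinnedChain_hamiltonian_nonneg hω.le hl.le hβ.le γ (N + 1) y
  have h1H : ∀ y, 1 ≤ 1 + P.hamiltonian (N + 1) y := fun y => by linarith [hH0 y]
  have eN : (⟨N + 1 - 1, Nat.sub_lt hNp one_pos⟩ : Fin (N + 1)) = Fin.last N := Fin.ext (by simp)
  have e0 : (⟨0, hNp⟩ : Fin (N + 1)) = 0 := rfl
  -- continuity
  have hp0c : Continuous p0f := by rw [hp0f]; fun_prop
  have hG1c : Continuous G1f := hG1c2.continuous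
  have hG2c : Continuous G2f := hG2c2.continuous
  have hΦc : Continuous Φf := by rw [hΦf]; fun_prop
  have hac : Continuous a := by rw [ha]; exact (by fun_prop : Continuous fun z : PhaseSpace (N + 1) => z.2 0).mul (hΦc.sub continuous_const)
  -- sizes
  set CΦ : ℝ := ω₂ + 1 + 6 * lam / ω₂ + 6 * β with hCΦ
  have hCΦ0 : 0 ≤ CΦ := by rw [hCΦ]; positivity
  have hΦb : ∀ y, |Φf y| ≤ CΦ * (1 + P.hamiltonian (N + 1) y) := fun y => by
    obtain ⟨h0, h1⟩ := classBd_phi_bounds hω hl.le hβ.le γ hN y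
    rw [hΦf]; dsimp only; rw [abs_of_nonneg h0]; exact h1
  have hab : ∀ y, |a y| ≤ (CΦ + |Φbar|) * (1 + P.hamiltonian (N + 1) y) ^ 2 := by
    intro y
    rw [ha]; dsimp only; rw [abs_mul]
    have hp : |y.2 0| ≤ 1 + P.hamiltonian (N + 1) y := abs_snd_le hl.le hβ.le γ hω.le y 0
    have hΦ' : |Φf y - Φbar| ≤ (CΦ + |Φbar|) * (1 + P.hamiltonian (N + 1) y) := by
      calc |Φf y - Φbar| ≤ |Φf y| + |Φbar| := abs_sub _ _
        _ ≤ CΦ * (1 + P.hamiltonian (N + 1) y) + |Φbar| * (1 + P.hamiltonian (N + 1) y) := by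
            refine add_le_add (hΦb y) ?_
            nlinarith [abs_nonneg Φbar, hH0 y]
        _ = (CΦ + |Φbar|) * (1 + P.hamiltonian (N + 1) y) := by ring
    calc |y.2 0| * |Φf y - Φbar| ≤ (1 + P.hamiltonian (N + 1) y) * ((CΦ + |Φbar|) * (1 + P.hamiltonian (N + 1) y)) :=
          mul_le_mul hp hΦ' (abs_nonneg _) (by linarith [hH0 y])
      _ = (CΦ + |Φbar|) * (1 + P.hamiltonian (N + 1) y) ^ 2 := by ring
  have hp0b : ∀ y, |p0f y| ≤ 1 * (1 + P.hamiltonian (N + 1) y) ^ 2 := fun y => by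
    rw [hp0f]; dsimp only; rw [one_mul]
    exact (abs_snd_le hl.le hβ.le γ hω.le y 0).trans (by nlinarith [hH0 y])
  have hG1b : ∀ y, |G1f y| ≤ Cb * (1 + P.hamiltonian (N + 1) y) ^ 2 := fun y => (hcls y).1
  have hG2b : ∀ y, |G2f y| ≤ Cb * (1 + P.hamiltonian (N + 1) y) ^ 2 := fun y => (hcls y).2.1
  have hG2b3 : ∀ y, |G2f y| ≤ Cb * (1 + P.hamiltonian (N + 1) y) ^ 3 := fun y =>
    (hG2b y).trans (mul_le_mul_of_nonneg_left (pow_le_pow_right₀ (h1H y) (by norm_num)) hCb0)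
  -- square integrability under `μ`
  have hsq : ∀ {f : PhaseSpace (N + 1) → ℝ} (_ : Continuous f) {C : ℝ} (k : ℕ)
      (_ : ∀ y, |f y| ≤ C * (1 + P.hamiltonian (N + 1) y) ^ k), Integrable (fun y => f y ^ 2) μ := by
    intro f hf C k hb
    refine statics_integrable_of_le_pow hω hl.le hβ.le γ (N + 1) hT (2 * k) (hf.pow 2) (C := C ^ 2) fun y => ?_
    rw [abs_of_nonneg (sq_nonneg _), pow_mul', ← mul_pow, ← sq_abs]
    exact pow_le_pow_left₀ (abs_nonneg _) (hb y) 2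
  have ha2 : Integrable (fun y => a y ^ 2) μ := hsq hac 2 hab
  have hp02 : Integrable (fun y => p0f y ^ 2) μ := hsq hp0c 2 hp0b
  have hG12 : Integrable (fun y => G1f y ^ 2) μ := hsq hG1c 2 hG1b
  have hG22 : Integrable (fun y => G2f y ^ 2) μ := hsq hG2c 2 hG2b
  have hG32 : Integrable (fun y => G₃ y ^ 2) μ := hsq hG₃c 3 hB₃
  -- pointwise Dynkin for the three pairs
  have hd1 : ∀ (ρ : ℝ≥0) (z : PhaseSpace (N + 1)), ∫ y, p0f y ∂(P.transitionKernel (N + 1) T T ρ z) - p0f z =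
      ∫ s in (0 : ℝ)..(ρ : ℝ), ∫ y, G1f y ∂(P.transitionKernel (N + 1) T T s.toNNReal z) := by
    refine sa_polyDynkin ω₂ lam β γ hω hl hβ hγ T hT (N + 1) 2 hNp p0f G1f 1 1 Cb (by rw [hp0f]; fun_prop)
      (fun x => hgen1 x) zero_le_one zero_le_one hCb0 hp0b (fun y => ?_) (fun y => ?_) hG1b
    · rw [hp0f, partialP_snd, e0, if_pos rfl, abs_one, one_mul]
      exact one_le_pow₀ (h1H y)
    · rw [hp0f, partialP_snd, eN]
      have : (0 : Fin (N + 1)) ≠ Fin.last N := classBd_zero_ne_last hN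
      rw [if_neg this]; simp only [abs_zero]; positivity
  have hd2 : ∀ (ρ : ℝ≥0) (z : PhaseSpace (N + 1)), ∫ y, G1f y ∂(P.transitionKernel (N + 1) T T ρ z) - G1f z =
      ∫ s in (0 : ℝ)..(ρ : ℝ), ∫ y, G2f y ∂(P.transitionKernel (N + 1) T T s.toNNReal z) := by
    refine sa_polyDynkin ω₂ lam β γ hω hl hβ hγ T hT (N + 1) 2 hNp G1f G2f Cb Cb Cb hG1c2
      (fun x => hgen2 x) hCb0 hCb0 hCb0 hG1b (fun y => ?_) (fun y => ?_) hG2b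
    · rw [e0]; exact (hcls y).2.2.1
    · rw [eN]; exact (hcls y).2.2.2.1
  have hd3 : ∀ (ρ : ℝ≥0) (z : PhaseSpace (N + 1)), ∫ y, G2f y ∂(P.transitionKernel (N + 1) T T ρ z) - G2f z =
      ∫ s in (0 : ℝ)..(ρ : ℝ), ∫ y, G₃ y ∂(P.transitionKernel (N + 1) T T s.toNNReal z) := by
    refine sa_polyDynkin ω₂ lam β γ hω hl hβ hγ T hT (N + 1) 3 hNp G2f G₃ Cb Cb B₃ hG2c2
      (fun x => hgen₃ x) hCb0 hCb0 ((abs_nonneg _).trans (hB₃ 0) |> fun h => ?_) hG2b3 (fun y => ?_) (fun y => ?_) hB₃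
    · exact nonneg_of_mul_nonneg_left h (pow_pos (by linarith [hH0 0]) 3)
    · rw [e0]; exact ((hcls y).2.2.2.2.1).trans (mul_le_mul_of_nonneg_left (pow_le_pow_right₀ (h1H y) (by norm_num)) hCb0)
    · rw [eN]; exact ((hcls y).2.2.2.2.2.1).trans (mul_le_mul_of_nonneg_left (pow_le_pow_right₀ (h1H y) (by norm_num)) hCb0)
  -- pairing with `a` under the invariant law
  have hinv : ∀ s : ℝ≥0, μ.bind (P.transitionKernel (N + 1) T T s) = μ := fun s =>
    pinnedChain_gibbsMeasure_bind_transitionKernel hω hl.le hβ.le hγ.le hNp hT s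
  set Af : ℝ → ℝ := fun t => ∫ z, a z * (∫ y, p0f y ∂(P.transitionKernel (N + 1) T T t.toNNReal z)) ∂μ with hAf
  set Bf : ℝ → ℝ := fun t => ∫ z, a z * (∫ y, G1f y ∂(P.transitionKernel (N + 1) T T t.toNNReal z)) ∂μ with hBf
  set Cf : ℝ → ℝ := fun t => ∫ z, a z * (∫ y, G2f y ∂(P.transitionKernel (N + 1) T T t.toNNReal z)) ∂μ with hCf
  set Df : ℝ → ℝ := fun t => ∫ z, a z * (∫ y, G₃ y ∂(P.transitionKernel (N + 1) T T t.toNNReal z)) ∂μ with hDf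
  have hpair1 : ∀ t, 0 ≤ t → Af t - ∫ y, a y * p0f y ∂μ = ∫ s in (0 : ℝ)..t, Bf s := fun t ht =>
    pinnedChain_integral_mul_act_sub_of_dynkin hω hl.le hβ.le hγ.le (N + 1) T T μ hinv hac.measurable
      hp0c.measurable hG1c.measurable ha2 hp02 hG12 hd1 ht
  have hpair2 : ∀ t, 0 ≤ t → Bf t - ∫ y, a y * G1f y ∂μ = ∫ s in (0 : ℝ)..t, Cf s := fun t ht =>
    pinnedChain_integral_mul_act_sub_of_dynkin hω hl.le hβ.le hγ.le (N + 1) T T μ hinv hac.measurable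
      hG1c.measurable hG2c.measurable ha2 hG12 hG22 hd2 ht
  have hpair3 : ∀ t, 0 ≤ t → Cf t - ∫ y, a y * G2f y ∂μ = ∫ s in (0 : ℝ)..t, Df s := fun t ht =>
    pinnedChain_integral_mul_act_sub_of_dynkin hω hl.le hβ.le hγ.le (N + 1) T T μ hinv hac.measurable
      hG2c.measurable hG₃c.measurable ha2 hG22 hG32 hd3 ht
  -- the statics
  have hs1 : ∫ y, a y * p0f y ∂μ = 0 := hst1
  have hs2 : ∫ y, a y * G1f y ∂μ = 0 := hst2
  have hs3 : ∫ y, a y * G2f y ∂μ = -(T * VΦ) := hst3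
  -- the remainder bound
  set ϑ : ℝ := 1 / (4 * T) with hϑ
  have hϑ0 : 0 < ϑ := by positivity
  have h2ϑ : 2 * ϑ < 1 / T := by
    rw [hϑ, show 2 * (1 / (4 * T)) = 1 / (2 * T) by field_simp; ring, div_lt_div_iff₀ (by positivity) hT]; nlinarith
  obtain ⟨K₂, hK₂⟩ : ∃ K, ∀ y, (1 + P.hamiltonian (N + 1) y) ^ 2 ≤ K * Real.exp (ϑ * P.hamiltonian (N + 1) y) :=
    ⟨_, fun y => LightConeBondHeat.one_add_pow_le_exp 2 (hH0 y) hϑ0⟩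
  obtain ⟨K₃, hK₃⟩ : ∃ K, ∀ y, (1 + P.hamiltonian (N + 1) y) ^ 3 ≤ K * Real.exp (ϑ * P.hamiltonian (N + 1) y) :=
    ⟨_, fun y => LightConeBondHeat.one_add_pow_le_exp 3 (hH0 y) hϑ0⟩
  have haM : ∀ y, |a y| ≤ ((CΦ + |Φbar|) * K₂) * Real.exp (ϑ * P.hamiltonian (N + 1) y) := fun y => by
    calc |a y| ≤ (CΦ + |Φbar|) * (1 + P.hamiltonian (N + 1) y) ^ 2 := hab y
      _ ≤ (CΦ + |Φbar|) * (K₂ * Real.exp (ϑ * P.hamiltonian (N + 1) y)) :=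
          mul_le_mul_of_nonneg_left (hK₂ y) (by positivity)
      _ = ((CΦ + |Φbar|) * K₂) * Real.exp (ϑ * P.hamiltonian (N + 1) y) := by ring
  have hB₃0 : 0 ≤ B₃ := nonneg_of_mul_nonneg_left ((abs_nonneg _).trans (hB₃ 0)) (pow_pos (by linarith [hH0 0]) 3)
  have hGM : ∀ y, |G₃ y| ≤ (B₃ * K₃) * Real.exp (ϑ * P.hamiltonian (N + 1) y) := fun y => by
    calc |G₃ y| ≤ B₃ * (1 + P.hamiltonian (N + 1) y) ^ 3 := hB₃ y
      _ ≤ B₃ * (K₃ * Real.exp (ϑ * P.hamiltonian (N + 1) y)) := mul_le_mul_of_nonneg_left (hK₃ y) hB₃0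
      _ = (B₃ * K₃) * Real.exp (ϑ * P.hamiltonian (N + 1) y) := by ring
  set MD : ℝ := ((∫ z, a z ^ 2 ∂μ) + ∫ z, G₃ z ^ 2 ∂μ) / 2 with hMD
  have hDb : ∀ w, 0 ≤ w → |Df w| ≤ MD := fun w _ =>
    prep_abs_corr_le hω hl.le hβ hγ hT hNp hϑ0 h2ϑ hac hG₃c haM hGM w.toNNReal
  -- measurability in time
  have hBm : Measurable Bf := CoherentDephasing.pinnedChain_measurable_corr hω hl.le hβ hγ hT hac hG1c
  have hCm : Measurable Cf := CoherentDephasing.pinnedChain_measurable_corr hω hl.le hβ hγ hT hac hG2c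
  -- the envelope
  have henv := prep_taylor3 (A := Af) (B := Bf) (C := Cf) (D := Df) (c₀ := -(T * VΦ)) (M := MD) hBm hCm
    (fun t ht => by have := hpair1 t ht; rw [hs1, sub_zero] at this; exact this)
    (fun t ht => by have := hpair2 t ht; rw [hs2, sub_zero] at this; exact this)
    (fun t ht => by have := hpair3 t ht; rw [hs3] at this; linarith) hDb r hr
  have e : Af r - -(T * VΦ) * r ^ 2 / 2 = Af r + T * VΦ * r ^ 2 / 2 := by ring
  rw [e] at henv
  exact henv

/-- **Registered form of the third-order expansion** (stub `sa_witnessExpansion`): closed statement of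
`expansion_of_cube`. [folklore] -/
theorem sa_witnessExpansion :
    ∀ ω₂ lam β γ : ℝ, 0 < ω₂ → 0 < lam → 0 < β → 0 < γ → ∀ T : ℝ, 0 < T → ∀ (N : ℕ) (hN : 2 ≤ N) (G₃ : PhaseSpace (N + 1) → ℝ) (B₃ : ℝ), Continuous G₃ → (∀ z : PhaseSpace (N + 1), (pinnedChain ω₂ lam β γ).generator (N + 1) T T (fun y : PhaseSpace (N + 1) => (-(y.2 0 * (ω₂ + 3 * lam * y.1 0 ^ 2 + 1 + 3 * β * (y.1 ⟨1, by omega⟩ - y.1 0) ^ 2)) + y.2 ⟨1, by omega⟩ * (1 + 3 * β * (y.1 ⟨1, by omega⟩ - y.1 0) ^ 2) + γ * (ω₂ * y.1 0 + lam * y.1 0 ^ 3 - ((y.1 ⟨1, by omega⟩ - y.1 0) + β * (y.1 ⟨1, by omega⟩ - y.1 0) ^ 3)) + γ ^ 2 * y.2 0)) z = G₃ z) → (∀ z, |G₃ z| ≤ B₃ * (1 + (pinnedChain ω₂ lam β γ).hamiltonian (N + 1) z) ^ 3) → ∀ r : ℝ, 0 ≤ r → |(∫ z, (z.2 0 * ((ω₂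 + 3 * lam * z.1 0 ^ 2 + 1 + 3 * β * (z.1 ⟨1, by omega⟩ - z.1 0) ^ 2) - ∫ x, (ω₂ + 3 * lam * x.1 0 ^ 2 + 1 + 3 * β * (x.1 ⟨1, by omega⟩ - x.1 0) ^ 2) ∂((pinnedChain ω₂ lam β γ).gibbsMeasure (N + 1) T))) * (∫ y, y.2 0 ∂((pinnedChain ω₂ lam β γ).transitionKernel (N + 1) T T r.toNNReal z)) ∂((pinnedChain ω₂ lam β γ).gibbsMeasure (N + 1) T)) + T * (∫ z, ((ω₂ + 3 * lam * z.1 0 ^ 2 + 1 + 3 * β * (z.1 ⟨1, by omega⟩ - z.1 0) ^ 2) - ∫ x, (ω₂ + 3 * lam * x.1 0 ^ 2 + 1 + 3 * β * (x.1 ⟨1, by omega⟩ - x.1 0) ^ 2) ∂((pinnedChain ω₂ lam β γ).gibbsMeasure (N + 1) T)) ^ 2 ∂((pinnedChain ω₂ lam β γ).gibbsMeasure (N + 1) T)) * r ^ 2 / 2| ≤ ((∫ z, (z.2 0 * ((ω₂ + 3 * lam * z.1 0 ^ 2 + 1 + 3 * β * (z.1 ⟨1, by omega⟩ - z.1 0)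 ^ 2) - ∫ x, (ω₂ + 3 * lam * x.1 0 ^ 2 + 1 + 3 * β * (x.1 ⟨1, by omega⟩ - x.1 0) ^ 2) ∂((pinnedChain ω₂ lam β γ).gibbsMeasure (N + 1) T))) ^ 2 ∂((pinnedChain ω₂ lam β γ).gibbsMeasure (N + 1) T)) + ∫ z, G₃ z ^ 2 ∂((pinnedChain ω₂ lam β γ).gibbsMeasure (N + 1) T)) / 2 * r ^ 3 / 6 :=
  fun _ _ _ _ hω hl hβ hγ _ hT _ hN _ _ hG₃c hgen₃ hB₃ r hr => expansion_of_cube hω hl hβ hγ hT hN hG₃c hgen₃ hB₃ r hr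

end Summit.AtomisticToContinuum.FouriersLaw.Theorems.CoherentDephasing.StrictAbsorption

end
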